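import Mathlib
import Summits.MatrixMultiplication.MatrixMultiplication.Theorems.SnSubsetDichotomyHyperoctahedralThresholdCleanPairIterate
import Summits.MatrixMultiplication.MatrixMultiplication.Theorems.SnSubsetDichotomyHyperoctahedralThresholdCleanPairAbsorb
import Summits.MatrixMultiplication.MatrixMultiplication.Theorems.SnSubsetDichotomyHyperoctahedralThresholdCleanPairTypical

/-!
# Clean-pair atom — assembly at fixed scale parameters (ATOM_PROOF §2 + §5)

Helper for crux `SnSubsetDichotomy.HyperoctahedralThreshold` (stmt-MatrixMultiplication-10883), line
`Lines/stub_plan_poorRigidCore.md`.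

* `eod_of_not_defect`: rungs without a defect are equal, swapped or disjoint.
* `cleanPair_of_params` / `stub_cleanPairOfParams`: absorbing set (`stub_absorbingSet`) → typical root for the separated family
  (`stub_typicalRootSep`) → largest cell (density `≥ D₀`) → either two members without mutual defect (the CLEAN PAIR, converted to the
  raw `foldl` format of `stub_cleanPairAtom`) or a totally dirty start level, excluded by `stub_noStartLevel`.
-/

-- the tree's namespace `Summit.MatrixMultiplication.MatrixMultiplication.…` repeats a component by design
set_option linter.dupNamespace false

namespace Summit.MatrixMultiplication.MatrixMultiplication.Theorems.HyperoctahedralThreshold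

namespace CleanPair

open TwinSupplyCS

variable {n : ℕ}

section Main

variable {μ : Fin 3 → Equiv.Perm (Fin n)} {F : Finset (Fin n)} {r : ℕ}

/-! ### From "no defect" to "equal, swapped or disjoint" -/

/-- If the rungs of `β` at `s` and of `β'` at `t` admit no defect, they are equal, swapped or disjoint (pure logic). -/
theorem eod_of_not_defect {μ : Fin 3 → Equiv.Perm (Fin n)} {p : Bool → Fin n} {β β' : List (Fin 3)} {s t : ℕ}
    (h : ¬ Defect μ p β β' s t) :
    (pos μ p β false s = pos μ p β' false t ∧ pos μ p β true s = pos μ p β' true t) ∨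
    (pos μ p β false s = pos μ p β' true t ∧ pos μ p β true s = pos μ p β' false t) ∨
    (pos μ p β false s ≠ pos μ p β' false t ∧ pos μ p β false s ≠ pos μ p β' true t ∧
      pos μ p β true s ≠ pos μ p β' false t ∧ pos μ p β true s ≠ pos μ p β' true t) := by
  simp only [Defect, not_exists, not_and, not_not] at h
  by_cases h1 : pos μ p β false s = pos μ p β' false t
  · exact Or.inl ⟨h1, by simpa using h false false h1⟩
  by_cases h2 : pos μ p β false s = pos μ p β' true t
  · exact Or.inr (Or.inl ⟨h2, by simpa using h false true h2⟩)
  refine Or.inr (Or.inr ⟨h1, h2, fun h3 => ?_, fun h4 => ?_⟩)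
  · exact h2 (by simpa using h true false h3)
  · exact h1 (by simpa using h true true h4)

/-! ### Assembly at fixed parameters -/

open Classical in
/-- **The clean pair, at given scale parameters.**  Under the numeric side conditions on `(n, a, r, s₀, t₁, B, C, dmin, D₀)`
and the uniform fixed-point bound `Φ₀` for nonempty reduced words of length `≤ 2a` (POOR via `SelfCleanDarts.poor_uniform`),
some root `v ≠ x` carries two distinct colliding reduced words of length `a` whose trajectories avoid `R` and whose rungs are
pairwise equal / swapped / disjoint. -/
theorem cleanPair_of_params (n a r s₀ t₁ B C dmin D₀ Φ₀ : ℕ) (μ : Fin 3 → Equiv.Perm (Fin n)) (R : Finset (Fin n))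
    (hμ : ∀ c, μ c * μ c = 1) (ha : 1 ≤ a) (hn : 2 ≤ n) (hra : r ≤ a) (hs₀ : 0 < s₀)
    (hΦ₀ : ∀ w : List (Fin 3), w ≠ [] → List.IsChain (· ≠ ·) w → w.length ≤ 2 * a →
      ((Finset.univ : Finset (Fin n)).filter (fun y => w.foldl (fun v b => μ b v) y = y)).card ≤ Φ₀)
    (hr : 288 * (a + 1) ^ 2 ≤ 2 ^ (r / 2)) (ht₁ : 3 * s₀ < 2 ^ (t₁ + 1)) (hΛ : 64 * (a + 1) ^ 2 ≤ Nat.sqrt s₀)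
    (hC : 3 * 2 ^ a < D₀ * 3 ^ (C + 1))
    (hB : 3 * 2 ^ a * (64 * (a + 1) ^ 2) ^ (B + 1) < D₀ * Nat.sqrt s₀ ^ (B + 1))
    (hdepth : 2 ^ B * (dmin + C * t₁) ≤ a) (hD₀ : 2 ^ (a - dmin + 1) ≤ D₀) (hdmin : dmin ≤ a)
    (hstart : 4 * n ^ 2 * D₀ ≤ 3 * 2 ^ a)
    (htyp : 16 * (a + 1) * (R.card + 3 * 2 ^ (2 * r + 1) * Φ₀ + 6 * a * s₀ * Φ₀) +
      16 * (a + 1) ^ 2 * (3 * 2 ^ (r + 1)) * (Φ₀ + 1) ≤ n) :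
    ∃ (v x : Fin n) (β β' : List (Fin 3)), v ≠ x ∧ β.length = a ∧ β'.length = a ∧ β ≠ β' ∧
      List.IsChain (· ≠ ·) β ∧ List.IsChain (· ≠ ·) β' ∧
      β.foldl (fun v b => μ b v) v = β'.foldl (fun v b => μ b v) v ∧ β.foldl (fun v b => μ b v) x = β'.foldl (fun v b => μ b v) x ∧
      (∀ t ≤ a, (β.take t).foldl (fun v b => μ b v) v ∉ R ∧ (β.take t).foldl (fun v b => μ b v) x ∉ R ∧
        (β'.take t).foldl (fun v b => μ b v) v ∉ R ∧ (β'.take t).foldl (fun v b => μ b v) x ∉ R) ∧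
      (∀ γ γ' : List (Fin 3), (γ = β ∨ γ = β') → (γ' = β ∨ γ' = β') → ∀ s ≤ a, ∀ t ≤ a,
        ((γ.take s).foldl (fun v b => μ b v) v = (γ'.take t).foldl (fun v b => μ b v) v ∧
            (γ.take s).foldl (fun v b => μ b v) x = (γ'.take t).foldl (fun v b => μ b v) x) ∨
          ((γ.take s).foldl (fun v b => μ b v) v = (γ'.take t).foldl (fun v b => μ b v) x ∧
            (γ.take s).foldl (fun v b => μ b v) x = (γ'.take t).foldl (fun v b => μ b v) v) ∨
          ((γ.take s).foldl (fun v b => μ b v) v ≠ (γ'.take t).foldl (fun v b => μ b v) v ∧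
            (γ.take s).foldl (fun v b => μ b v) v ≠ (γ'.take t).foldl (fun v b => μ b v) x ∧
            (γ.take s).foldl (fun v b => μ b v) x ≠ (γ'.take t).foldl (fun v b => μ b v) v ∧
            (γ.take s).foldl (fun v b => μ b v) x ≠ (γ'.take t).foldl (fun v b => μ b v) x)) := by
  -- the absorbing set
  obtain ⟨F, hRF, hFcyc, hFdense, hFcard⟩ := stub_absorbingSet n a r s₀ Φ₀ μ R hμ hra hs₀ hΦ₀
  -- a typical root for Φ' = F-avoiding ∧ r-separated
  have hΦ₀' : ∀ w : List (Fin 3), w ≠ [] → List.IsChain (· ≠ ·) w → w.length ≤ a + r →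
      ((Finset.univ : Finset (Fin n)).filter (fun y => w.foldl (fun v b => μ b v) y = y)).card ≤ Φ₀ :=
    fun w h1 h2 h3 => hΦ₀ w h1 h2 (by omega)
  have htyp' : 16 * (a + 1) * F.card + 16 * (a + 1) ^ 2 * (3 * 2 ^ (r + 1)) * (Φ₀ + 1) ≤ n :=
    le_trans (Nat.add_le_add_right (Nat.mul_le_mul_left _ hFcard) _) htyp
  obtain ⟨v, x, hvx, hbig⟩ := stub_typicalRootSep n a r Φ₀ μ F hμ ha hn hΦ₀' htyp'
  set p : Bool → Fin n := fun σ => bif σ then x else v with hp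
  set Φ' := (RW a).filter (fun β => Avoids μ F p β ∧ Separated μ r p β) with hΦ'
  -- the largest cell
  obtain ⟨⟨y, z⟩, -, hcell⟩ := exists_fiber_card_ge Φ' ((Finset.univ : Finset (Fin n)) ×ˢ (Finset.univ : Finset (Fin n)))
    (fun β => (pos μ p β false a, pos μ p β true a)) (fun _ _ => by simp) ⟨(v, v), by simp⟩
  set Cell := Φ'.filter (fun β => (pos μ p β false a, pos μ p β true a) = (y, z)) with hCell
  have hCellsub : Cell ⊆ Φ' := Finset.filter_subset _ _
  have hn2 : ((Finset.univ : Finset (Fin n)) ×ˢ (Finset.univ : Finset (Fin n))).card = n ^ 2 := by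
    simp [Finset.card_univ, sq]
  rw [hn2] at hcell
  have hD₀Cell : D₀ ≤ Cell.card := by
    have h1 : 4 * (n ^ 2 * D₀) ≤ 4 * (n ^ 2 * Cell.card) :=
      calc 4 * (n ^ 2 * D₀) = 4 * n ^ 2 * D₀ := by ring
        _ ≤ 3 * 2 ^ a := hstart
        _ ≤ 4 * Φ'.card := hbig
        _ ≤ 4 * (n ^ 2 * Cell.card) := Nat.mul_le_mul_left _ hcell
    exact Nat.le_of_mul_le_mul_left (Nat.le_of_mul_le_mul_left h1 (by norm_num)) (by positivity)
  -- members of the cell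
  have hmemCell : ∀ β ∈ Cell, (β.length = a ∧ List.IsChain (· ≠ ·) β) ∧ (Avoids μ F p β ∧ Separated μ r p β) ∧
      pos μ p β false a = y ∧ pos μ p β true a = z := by
    intro β hβ
    rw [hCell, Finset.mem_filter, hΦ', Finset.mem_filter, mem_RW, Prod.mk.injEq] at hβ
    exact ⟨hβ.1.1, hβ.1.2, hβ.2.1, hβ.2.2⟩
  -- either a pair without defect, or the cell is a totally dirty level (impossible)
  by_cases hclean : ∃ β ∈ Cell, ∃ β' ∈ Cell, β ≠ β' ∧ ∀ s ≤ a, ∀ t ≤ a, ¬ Defect μ p β β' s t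
  · obtain ⟨β, hβ, β', hβ', hne, hnd⟩ := hclean
    obtain ⟨⟨hlen, hc⟩, ⟨hA, hS⟩, hy, hz⟩ := hmemCell β hβ
    obtain ⟨⟨hlen', hc'⟩, ⟨hA', hS'⟩, hy', hz'⟩ := hmemCell β' hβ'
    -- dictionary between `pos` and the raw `foldl` form
    have ev : ∀ γ : List (Fin 3), ∀ s, (γ.take s).foldl (fun v b => μ b v) v = pos μ p γ false s := fun γ s => rfl
    have ex : ∀ γ : List (Fin 3), ∀ s, (γ.take s).foldl (fun v b => μ b v) x = pos μ p γ true s := fun γ s => rfl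
    have eod : ∀ γ γ' : List (Fin 3), (∀ s ≤ a, ∀ t ≤ a, ¬ Defect μ p γ γ' s t) → ∀ s ≤ a, ∀ t ≤ a,
        ((γ.take s).foldl (fun v b => μ b v) v = (γ'.take t).foldl (fun v b => μ b v) v ∧
            (γ.take s).foldl (fun v b => μ b v) x = (γ'.take t).foldl (fun v b => μ b v) x) ∨
          ((γ.take s).foldl (fun v b => μ b v) v = (γ'.take t).foldl (fun v b => μ b v) x ∧
            (γ.take s).foldl (fun v b => μ b v) x = (γ'.take t).foldl (fun v b => μ b v) v) ∨
          ((γ.take s).foldl (fun v b => μ b v) v ≠ (γ'.take t).foldl (fun v b => μ b v) v ∧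
            (γ.take s).foldl (fun v b => μ b v) v ≠ (γ'.take t).foldl (fun v b => μ b v) x ∧
            (γ.take s).foldl (fun v b => μ b v) x ≠ (γ'.take t).foldl (fun v b => μ b v) v ∧
            (γ.take s).foldl (fun v b => μ b v) x ≠ (γ'.take t).foldl (fun v b => μ b v) x) := by
      intro γ γ' hγ s hs t ht
      rw [ev, ev, ex, ex]
      exact eod_of_not_defect (hγ s hs t ht)
    have hself : ∀ γ, γ ∈ Cell → ∀ s ≤ a, ∀ t ≤ a, ¬ Defect μ p γ γ s t := by
      intro γ hγ s hs t ht
      obtain ⟨⟨hlenγ, hcγ⟩, ⟨hAγ, hSγ⟩, -, -⟩ := hmemCell γ hγ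
      exact no_self_defect hFcyc hcγ hAγ hSγ (by omega) (by omega)
    have hfull : ∀ s, β.take s = (β.take a).take s → True := fun _ _ => trivial
    refine ⟨v, x, β, β', hvx, hlen, hlen', hne, hc, hc', ?_, ?_, ?_, ?_⟩
    · -- collide on the v-side
      have := hy.trans hy'.symm
      simp only [pos] at this
      rwa [List.take_of_length_le (by omega), List.take_of_length_le (by omega)] at this
    · have := hz.trans hz'.symm
      simp only [pos] at this
      rwa [List.take_of_length_le (by omega), List.take_of_length_le (by omega)] at this
    · intro t ht
      rw [ev, ex, ev, ex]
      exact ⟨fun h => hA false t (by omega) (hRF h), fun h => hA true t (by omega) (hRF h),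
        fun h => hA' false t (by omega) (hRF h), fun h => hA' true t (by omega) (hRF h)⟩
    · rintro γ γ' (rfl | rfl) (rfl | rfl)
      · exact eod _ _ (hself _ hβ)
      · exact eod _ _ hnd
      · exact eod _ _ (fun s hs t ht hd => hnd t ht s hs hd.symm)
      · exact eod _ _ (hself _ hβ')
  · -- totally dirty: the cell is a start level, contradiction
    exfalso
    push Not at hclean
    have hI : Inv μ F r p a Cell := by
      refine ⟨?_, ?_, ?_, ?_⟩
      · simpa [hp] using hvx
      · intro β hβ
        obtain ⟨⟨hlen, hc⟩, ⟨hA, hS⟩, -, -⟩ := hmemCell β hβ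
        exact ⟨hlen, hc, hA, hS⟩
      · intro β hβ β' hβ' σ
        obtain ⟨-, -, hy, hz⟩ := hmemCell β hβ
        obtain ⟨-, -, hy', hz'⟩ := hmemCell β' hβ'
        cases σ
        · exact hy.trans hy'.symm
        · exact hz.trans hz'.symm
      · intro β hβ β' hβ' hne
        obtain ⟨s, hs, t, ht, hd⟩ := hclean β hβ β' hβ' hne
        exact ⟨s, hs, t, ht, hd⟩
    exact no_start_level hμ hFcyc hs₀ hFdense hr ht₁ hΛ hC hB hdepth hD₀ hdmin hI hD₀Cell

end Main

end CleanPair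

open CleanPair in
/-- **`stub_cleanPairOfParams`** (registered sub-goal of stmt-MatrixMultiplication-10883): the clean pair at given scale parameters
(ATOM_PROOF §2/§5 assembly). -/
theorem stub_cleanPairOfParams : ∀ (n a r s₀ t₁ B C dmin D₀ Φ₀ : ℕ) (μ : Fin 3 → Equiv.Perm (Fin n)) (R : Finset (Fin n)), (∀ c, μ c * μ c = 1) → 1 ≤ a → 2 ≤ n → r ≤ a → 0 < s₀ → (∀ w : List (Fin 3), w ≠ [] → List.IsChain (· ≠ ·) w → w.length ≤ 2 * a → ((Finset.univ : Finset (Fin n)).filter (fun y => w.foldl (fun v b => μ b v) y = y)).card ≤ Φ₀) → 288 * (a + 1) ^ 2 ≤ 2 ^ (r / 2) → 3 * s₀ < 2 ^ (t₁ + 1) → 64 * (a + 1) ^ 2 ≤ Nat.sqrt s₀ → 3 * 2 ^ a < D₀ * 3 ^ (C + 1) → 3 * 2 ^ a * (64 * (a + 1) ^ 2) ^ (B + 1) < D₀ * Nat.sqrt s₀ ^ (B + 1) → 2 ^ B * (dmin + C * t₁) ≤ a → 2 ^ (a - dmin + 1) ≤ D₀ → dmin ≤ a → 4 * n ^ 2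 * D₀ ≤ 3 * 2 ^ a → 16 * (a + 1) * (R.card + 3 * 2 ^ (2 * r + 1) * Φ₀ + 6 * a * s₀ * Φ₀) + 16 * (a + 1) ^ 2 * (3 * 2 ^ (r + 1)) * (Φ₀ + 1) ≤ n → ∃ (v x : Fin n) (β β' : List (Fin 3)), v ≠ x ∧ β.length = a ∧ β'.length = a ∧ β ≠ β' ∧ List.IsChain (· ≠ ·) β ∧ List.IsChain (· ≠ ·) β' ∧ β.foldl (fun v b => μ b v) v = β'.foldl (fun v b => μ b v) v ∧ β.foldl (fun v b => μ b v) x = β'.foldl (fun v b => μ b v) x ∧ (∀ t ≤ a, (β.take t).foldl (fun v b => μ b v) v ∉ R ∧ (β.take t).foldl (fun v b => μ b v) x ∉ R ∧ (β'.take t).foldl (fun v b => μ b v) v ∉ R ∧ (β'.take t).foldl (fun v b => μ b v) x ∉ R) ∧ (∀ γ γ' : List (Fin 3), (γ = β ∨ γ = β') → (γ' = β ∨ γ' = β') → ∀ s ≤ a, ∀ t ≤ a, ((γ.take s).foldl (fun v b => μ b v) v = (γ'.take t).foldl (fun v b => μ b v) v ∧ (γ.take s).foldl (fun v b => μ b v)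 x = (γ'.take t).foldl (fun v b => μ b v) x) ∨ ((γ.take s).foldl (fun v b => μ b v) v = (γ'.take t).foldl (fun v b => μ b v) x ∧ (γ.take s).foldl (fun v b => μ b v) x = (γ'.take t).foldl (fun v b => μ b v) v) ∨ ((γ.take s).foldl (fun v b => μ b v) v ≠ (γ'.take t).foldl (fun v b => μ b v) v ∧ (γ.take s).foldl (fun v b => μ b v) v ≠ (γ'.take t).foldl (fun v b => μ b v) x ∧ (γ.take s).foldl (fun v b => μ b v) x ≠ (γ'.take t).foldl (fun v b => μ b v) v ∧ (γ.take s).foldl (fun v b => μ b v) x ≠ (γ'.take t).foldl (fun v b => μ b v) x)) :=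
  fun n a r s₀ t₁ B C dmin D₀ Φ₀ μ R hμ ha hn hra hs₀ hΦ₀ hr ht₁ hΛ hC hB hdepth hD₀ hdmin hstart htyp =>
    cleanPair_of_params n a r s₀ t₁ B C dmin D₀ Φ₀ μ R hμ ha hn hra hs₀ hΦ₀ hr ht₁ hΛ hC hB hdepth hD₀ hdmin hstart htyp

end Summit.MatrixMultiplication.MatrixMultiplication.Theorems.HyperoctahedralThreshold
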